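import Summits.QuantumFields.YangMills.Theorems.BalabanUVNodesN08AxialLaunderingFirstBond

/-!
# BalabanUVNodes ∕ N08 — WEIGHTED LAUNDERING ALONG THE AXIAL REFERENCE, FREE-END FORM: choose, PER SEGMENT, which end the density does not read (the last bond for the
# segments in `T`, the first bond for the others); then `(f·dU_j)∘Ū_ax⁻¹ = (∫f)•dU_{j+1}` — mixed right∕left translations, reduced to Weil's uniqueness by inverting the
# coordinates outside `T` (product Haar is inversion-invariant)

Track A, DAG node N08 ([Balaban1985UV3] Thm 1 p. 257 ∕ Thm 2 p. 272; averaging [Balaban1987RG1] (0.4) p. 253; straight transporter [Balaban1984PropagatorsI] (1.7) p. 18).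
Cell `pub-ymgap`, seat `pub-ymgap-dag-n08-d` g47 (R529-ym summon; DESIGN memo (M1′)); `--supports stmt-QuantumFields-19936` (helper).  Completes the laundering toolkit
✓p754299 (all free ends LAST) ∕ (first-bond twin, `…AxialLaunderingFirstBond`): a bump supported on a bond set containing NO FULL straight segment is invisible one level up,
whatever mixture of ends is free — the form the one-cluster invisibility theorem (M4) consumes.

CONTENTS ([folklore]; 0 `def`, 0 `sorry`): `measurable_invOff` ∕ `invOff_invOff` ∕ `map_invOff_fieldMeasure` (partial coordinatewise inversion is a measurable involution
preserving product Haar); ★★★ `map_withDensity_axialAvg_eq_smul_of_freeEnd`.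
HONEST: count-neutral helper; hTop ∕ (a)′∀ ∕ hJ NOT proved; N08 NOT discharged; R3 ≠ d = 4 ∕ mass gap ∕ Clay.
-/

noncomputable section

open MeasureTheory
open scoped ENNReal

namespace Summit.QuantumFields.YangMills.Theorems.BalabanUVNodesN08AxialLaunderingFreeEnd

open Literature.MathematicalPhysics.QuantumFieldTheory.Balaban1983to89
open Literature.MathematicalPhysics.QuantumFieldTheory.Balaban1983to89.AveragingRT
open Summit.QuantumFields.YangMills.Theorems.BalabanUVNodesN08AxialLaunderingWeighted (map_withDensity_eq_of_comp_eq)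
open Summit.QuantumFields.YangMills.Theorems.BalabanUVNodesN08AxialLaunderingFirstBond (axialAvg_mul_first)

variable {P : Params} {j : ℕ} {G : Type*} [GaugeGroup G] [MeasurableSpace G] [HaarData G] [MeasurableMul₂ G] [MeasurableInv G]

/-! ## §1 Partial coordinatewise inversion -/

omit [HaarData G] [MeasurableMul₂ G] in
/-- Partial coordinatewise inversion (invert the coordinates OFF `T`) is measurable. [folklore] -/
theorem measurable_invOff (T : Set (PBond P (j + 1))) [DecidablePred (· ∈ T)] :
    Measurable (fun (V : GaugeField P (j + 1) G) (c : PBond P (j + 1)) => if c ∈ T then V c else (V c)⁻¹) := by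
  refine measurable_pi_iff.mpr fun c => ?_
  by_cases hc : c ∈ T
  · simp only [hc, if_true]; exact measurable_pi_apply c
  · simp only [hc, if_false]; exact (measurable_pi_apply c).inv

omit [MeasurableSpace G] [HaarData G] [MeasurableMul₂ G] [MeasurableInv G] in
/-- … is an involution. [folklore] -/
theorem invOff_invOff (T : Set (PBond P (j + 1))) [DecidablePred (· ∈ T)] (V : GaugeField P (j + 1) G) :
    (fun (c : PBond P (j + 1)) => if c ∈ T then (fun c' => if c' ∈ T then V c' else (V c')⁻¹) c
      else ((fun c' => if c' ∈ T then V c' else (V c')⁻¹) c)⁻¹) = V := by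
  funext c
  by_cases hc : c ∈ T <;> simp [hc]

omit [MeasurableMul₂ G] in
/-- … and preserves product Haar (`HaarData.map_inv` on the inverted coordinates). [folklore] -/
theorem map_invOff_fieldMeasure (T : Set (PBond P (j + 1))) [DecidablePred (· ∈ T)] :
    (fieldMeasure P (j + 1) G).map (fun (V : GaugeField P (j + 1) G) (c : PBond P (j + 1)) => if c ∈ T then V c else (V c)⁻¹) =
      fieldMeasure P (j + 1) G := by
  have h := measurePreserving_pi (fun _ : PBond P (j + 1) => (HaarData.haar : Measure G)) (fun _ => HaarData.haar)
    (f := fun c (x : G) => if c ∈ T then x else x⁻¹)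
    (fun c => by
      by_cases hc : c ∈ T
      · simp only [hc, if_true]; exact ⟨measurable_id, Measure.map_id⟩
      · simp only [hc, if_false]; exact ⟨measurable_inv, HaarData.map_inv⟩)
  unfold fieldMeasure
  exact h.map_eq

/-! ## §2 The free-end laundering theorem -/

/-- ★★★ **WEIGHTED LAUNDERING, FREE-END FORM.**  Let `T` be a set of coarse bonds (segments).  If the measurable density `f ≥ 0` (finite integral) is invariant under
right-multiplication of the LAST bonds of the segments in `T` (by any coarse field supported on `T`) and under left-multiplication of the FIRST bonds of the segments outside
`T` (by any coarse field supported off `T`), then `((dU_j).withDensity f).map axialAvg = (∫⁻ f dU_j) • dU_{j+1}` (standing range).  Proof: transport by the partial inversion off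
`T`; the transported push-forward is right-invariant under ALL coarse translations (`axialAvg_mul_last` on `T`, `axialAvg_mul_first` off `T`), hence a multiple of product Haar
(Weil), and product Haar is invariant under the partial inversion. [cite: Balaban1984PropagatorsI, (1.7) p.18; Balaban1985Averaging, (10) p.19 (bookkeeping)] -/
theorem map_withDensity_axialAvg_eq_smul_of_freeEnd (hj : j + 1 ≤ P.m + P.K) (T : Set (PBond P (j + 1))) [DecidablePred (· ∈ T)]
    {f : GaugeField P j G → ℝ≥0∞} (hf : Measurable f) (hfin : ∫⁻ U, f U ∂(fieldMeasure P j G) ≠ ∞)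
    (hlast : ∀ (g : GaugeField P (j + 1) G), (∀ c, c ∉ T → g c = 1) → ∀ U : GaugeField P j G,
      f (fun b => U b * Function.extend (fun c : PBond P (j + 1) => line c (P.L - 1)) g (fun _ => 1) b) = f U)
    (hfirst : ∀ (g : GaugeField P (j + 1) G), (∀ c, c ∈ T → g c = 1) → ∀ U : GaugeField P j G,
      f (fun b => Function.extend (fun c : PBond P (j + 1) => line c 0) g (fun _ => 1) b * U b) = f U) :
    ((fieldMeasure P j G).withDensity f).map (axialAvg : GaugeField P j G → GaugeField P (j + 1) G) =
      (∫⁻ U, f U ∂(fieldMeasure P j G)) • fieldMeasure P (j + 1) G := by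
  letI : Group (GaugeField P (j + 1) G) := Pi.group
  letI : MeasurableMul₂ (GaugeField P (j + 1) G) := Pi.measurableMul₂
  set ψ : GaugeField P (j + 1) G → GaugeField P (j + 1) G := fun V c => if c ∈ T then V c else (V c)⁻¹ with hψ
  have hψm : Measurable ψ := measurable_invOff (G := G) T
  have hψψ : ∀ V, ψ (ψ V) = V := fun V => invOff_invOff (G := G) T V
  have hmeas : Measurable (axialAvg : GaugeField P j G → GaugeField P (j + 1) G) := measurable_axialAvg
  haveI : IsFiniteMeasure ((fieldMeasure P j G).withDensity f) := isFiniteMeasure_withDensity hfin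
  set κ := ((fieldMeasure P j G).withDensity f).map (axialAvg : GaugeField P j G → GaugeField P (j + 1) G) with hκ
  haveI : IsFiniteMeasure κ := Measure.isFiniteMeasure_map _ _
  haveI : IsFiniteMeasure (κ.map ψ) := Measure.isFiniteMeasure_map _ _
  -- (i) `κ` is invariant under right translations supported on `T`
  have hright : ∀ g : GaugeField P (j + 1) G, (∀ c, c ∉ T → g c = 1) → κ.map (fun x => x * g) = κ := by
    intro g hg
    set R : GaugeField P j G → GaugeField P j G := fun U b =>
      U b * Function.extend (fun c : PBond P (j + 1) => line c (P.L - 1)) g (fun _ => 1) b with hR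
    have hRmp : MeasurePreserving R (fieldMeasure P j G) (fieldMeasure P j G) := measurePreserving_mulRight _
    have hRf : ((fieldMeasure P j G).withDensity f).map R = (fieldMeasure P j G).withDensity f :=
      map_withDensity_eq_of_comp_eq hRmp hf (fun U => hlast g hg U)
    have hcomp : ((fun x => x * g) ∘ (axialAvg : GaugeField P j G → GaugeField P (j + 1) G)) = axialAvg ∘ R := by
      funext U; show (fun c => axialAvg U c * g c) = axialAvg (R U); rw [hR, axialAvg_mul_last hj]
    calc κ.map (fun x => x * g) = ((fieldMeasure P j G).withDensity f).map ((fun x => x * g) ∘ axialAvg) := by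
          rw [hκ, Measure.map_map (measurable_mul_const g) hmeas]
      _ = ((fieldMeasure P j G).withDensity f).map (axialAvg ∘ R) := by rw [hcomp]
      _ = (((fieldMeasure P j G).withDensity f).map R).map axialAvg := (Measure.map_map hmeas hRmp.measurable).symm
      _ = κ := by rw [hRf]
  -- (ii) `κ` is invariant under left translations supported off `T`
  have hleft : ∀ g : GaugeField P (j + 1) G, (∀ c, c ∈ T → g c = 1) → κ.map (fun x => g * x) = κ := by
    intro g hg
    set Lg : GaugeField P j G → GaugeField P j G := fun U b =>
      Function.extend (fun c : PBond P (j + 1) => line c 0) g (fun _ => 1) b * U b with hLg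
    have hLmp : MeasurePreserving Lg (fieldMeasure P j G) (fieldMeasure P j G) := measurePreserving_mulLeft _
    have hLf : ((fieldMeasure P j G).withDensity f).map Lg = (fieldMeasure P j G).withDensity f :=
      map_withDensity_eq_of_comp_eq hLmp hf (fun U => hfirst g hg U)
    have hcomp : ((fun x => g * x) ∘ (axialAvg : GaugeField P j G → GaugeField P (j + 1) G)) = axialAvg ∘ Lg := by
      funext U; show (fun c => g c * axialAvg U c) = axialAvg (Lg U); rw [hLg, axialAvg_mul_first hj]
    calc κ.map (fun x => g * x) = ((fieldMeasure P j G).withDensity f).map ((fun x => g * x) ∘ axialAvg) := by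
          rw [hκ, Measure.map_map (measurable_const_mul g) hmeas]
      _ = ((fieldMeasure P j G).withDensity f).map (axialAvg ∘ Lg) := by rw [hcomp]
      _ = (((fieldMeasure P j G).withDensity f).map Lg).map axialAvg := (Measure.map_map hmeas hLmp.measurable).symm
      _ = κ := by rw [hLf]
  -- (iii) `κ.map ψ` is right-invariant under ALL translations
  have hinv : ∀ g : GaugeField P (j + 1) G, (κ.map ψ).map (fun x => x * g) = κ.map ψ := by
    intro g
    set gT : GaugeField P (j + 1) G := fun c => if c ∈ T then g c else 1 with hgT
    set gC : GaugeField P (j + 1) G := fun c => if c ∈ T then 1 else (g c)⁻¹ with hgC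
    have hgT1 : ∀ c, c ∉ T → gT c = 1 := fun c hc => by simp [hgT, hc]
    have hgC1 : ∀ c, c ∈ T → gC c = 1 := fun c hc => by simp [hgC, hc]
    have hcomp : ((fun x => x * g) ∘ ψ) = ψ ∘ (fun V => gC * (V * gT)) := by
      funext V; funext c
      show ψ V c * g c = ψ (fun c' => gC c' * (V c' * gT c')) c
      by_cases hc : c ∈ T
      · simp [hψ, hgT, hgC, hc]
      · simp [hψ, hgT, hgC, hc]
    calc (κ.map ψ).map (fun x => x * g) = κ.map ((fun x => x * g) ∘ ψ) := Measure.map_map (measurable_mul_const g) hψm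
      _ = κ.map (ψ ∘ (fun V => gC * (V * gT))) := by rw [hcomp]
      _ = ((κ.map (fun V => V * gT)).map (fun V => gC * V)).map ψ := by
          rw [Measure.map_map hψm (measurable_const_mul gC), Measure.map_map (hψm.comp (measurable_const_mul gC)) (measurable_mul_const gT)]
          rfl
      _ = κ.map ψ := by rw [hright gT hgT1, hleft gC hgC1]
  -- (iv) Weil for `κ.map ψ`, then undo `ψ`
  have hW := measure_eq_mass_smul_of_invariant (fieldMeasure P (j + 1) G) (κ.map ψ)
    (fun g => (measurePreserving_mulLeft (P := P) (j := j + 1) g).map_eq) hinv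
  have hmass : (κ.map ψ) Set.univ = ∫⁻ U, f U ∂(fieldMeasure P j G) := by
    rw [Measure.map_apply hψm MeasurableSet.univ, Set.preimage_univ, hκ, Measure.map_apply hmeas MeasurableSet.univ, Set.preimage_univ,
      withDensity_apply _ MeasurableSet.univ, Measure.restrict_univ]
  have hback : κ = (κ.map ψ).map ψ := by
    rw [Measure.map_map hψm hψm]
    have : (ψ ∘ ψ) = id := funext fun V => hψψ V
    rw [this, Measure.map_id]
  have hπψ : (fieldMeasure P (j + 1) G).map ψ = fieldMeasure P (j + 1) G := by
    rw [hψ]; exact map_invOff_fieldMeasure (G := G) T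
  rw [hback, hW, hmass, Measure.map_smul, hπψ]

end Summit.QuantumFields.YangMills.Theorems.BalabanUVNodesN08AxialLaunderingFreeEnd

end
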